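import Literature.Barriers.ResolutionOfSingularities.ResidualOrderUnboundedHolds
import Mathlib.Algebra.MvPolynomial.Expand

/-!
# Narrowed barrier: how far Hauser–Perlega's divergence of the residual order actually reaches

`Literature/Barriers/ResolutionOfSingularities/ResidualOrderUnboundedNarrow.lean` — barrier AUDIT
(D-0021, 2026-08-16) of the catalogue entry `ResidualOrderUnbounded.lean` (Hauser–Perlega 2019:
along suitable point blow-ups the residual order of `z^{pᵉ} + F(x) = 0` tends to infinity, so
Moh's Stability Theorem fails for `e ≥ 3`), whose named fact `HauserPerlega2019` is discharged in
`ResidualOrderUnboundedHolds.lean`. Verdict: ESTABLISHED, technique class NARROWED — the printed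
and formal argument covers exactly the claims that are UNIFORM OVER THE CHOICE OF PERMISSIBLE
CENTRES (Moh's programme: a bound along every permissible sequence with `ord f` constant), for
every `e ≥ 3` and every `n ≥ 5` (`p = 2`) / `n ≥ 4` (`p` odd); it says nothing about strategies
whose centres are prescribed by the singularity (larger centres are available and evade), about
the ONE-blow-up bound (true), about `e ≤ 2`, or about fewer variables. This file sits downstream
of the discharge files because its proofs use them (the parent file cannot import them); the
narrowed D-0021 block is the docstring of `ResidualOrderUnboundedNarrow` below.

## What is proved
* Reach in `e` (section `Expand`): the Frobenius twist `MvPolynomial.expand p` (`F ↦ F(xᵖ)`)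
  turns a point blow-up sequence for `ord f = q` into one for `ord f = p·q`
  (`IsPointBlowupSequence.expand`: translations replaced by `p`-th roots, cleaning for `p·q`,
  residual orders multiplied by `p` — `residualOrder_expand`), whence
  `HasDivergentPointBlowupSequence p e n K → HasDivergentPointBlowupSequence p (e+1) n K` over an
  algebraically closed field (`HasDivergentPointBlowupSequence.exp_succ`, `.of_exp_le`).
* Reach in `n` (section `Rename`): renaming along an injection of variable sets preserves every
  construction of the §2 setting (`IsPointBlowupSequence.rename`, `residualOrder_rename`), whence
  `n ↦ n + 1` (`HasDivergentPointBlowupSequence.vars_succ`, `.of_vars_le`).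
* Permissible coordinate centres `P = (z, xᵢ : i ∈ Γ)` in the printed sense of §2
  (`IsPermissibleCentre`; "The maximal ideal always defines a permissible center":
  `isPermissibleCentre_univ`), and for the starting polynomial `F⁰ = x⁴y⁴w⁶(w² + x³u¹⁰)` of the
  first example: residual order `2` (`Example1.residualOrder_F0`), the `3`-dimensional centres
  `(z, x, w)` and `(z, u, w)` of `𝔸⁶` are permissible (`Example1.isPermissibleCentre_F0_xw`,
  `Example1.isPermissibleCentre_F0_uw`) while no `4`-dimensional coordinate centre is
  (`Example1.not_isPermissibleCentre_F0_singleton`) — Hauser–Perlega blow up the point.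
* The narrowed barrier `ResidualOrderUnboundedNarrow`, its proof
  `residualOrderUnboundedNarrow_holds`, the comparison `hauserPerlega2019_of_narrow`, and
  `mohStability_fails_for_each_e` (Moh's bound `d + 2^{e−1}` is exceeded for EACH `e ≥ 3`).

Pages checked for the audit: [cite: HauserPerlega2019, §1] (main statement; "The centers are
always points"; "Taking larger centers would prevent the phenomenon from happening"), §2 (setting,
permissible centres), §3 (Moh's claim; "This disproves Moh's claim in the case `e ≥ 3` (it is
known to be valid for `e = 1`)"; "one could choose at various instances a larger center"), §4
(both examples, "All blowups are point blowups"); [cite: Moh1987, pp. 966–967] (the Stability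
Theorem verbatim with its hypotheses — residually rational valuation, `0 ≤ mᵢ < pᵉ`,
`(∏ xᵢ^{mᵢ}) F_d` not a `pᵉ`-th power — all met by the examples); [cite: HauserPerlega2019PRIMS, §1]
(Theorem: the one-blow-up increase is `≤ c!/p`, extending Moh's bound — true, not refuted);
[cite: Perlega2020, Introduction §4] (surfaces in a regular threefold, every `e`, are resolved by a
corrected residual order).
-/

noncomputable section

open MvPolynomial Finset

open scoped BigOperators

namespace Literature.Barriers.ResolutionOfSingularities

open Literature.AlgebraicGeometry.Resolution.Hauser2010

namespace HauserPerlega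

/-! ## Orders as infima over the support -/

section OrdInf

variable {σ : Type*} {K : Type*} [CommRing K]

/-- `ord₀ P` is the least degree of a monomial of `P` (`⊤` for `P = 0`). [folklore] -/
theorem ordZero_eq_inf_support (P : MvPolynomial σ K) :
    ordZero P = P.support.inf fun d => ((d.degree : ℕ) : ℕ∞) := by
  by_cases hP : P = 0
  · subst hP; simp [ordZero_zero]
  have hne : P.support.Nonempty :=
    Finset.nonempty_of_ne_empty (mt MvPolynomial.support_eq_empty.mp hP)
  obtain ⟨d₀, hd₀, hmin⟩ :=
    Finset.exists_mem_eq_inf P.support hne (fun d => ((d.degree : ℕ) : ℕ∞))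
  rw [hmin, ordZero_eq_nat_iff]
  refine ⟨⟨d₀, MvPolynomial.mem_support_iff.mp hd₀, rfl⟩, fun d hd => ?_⟩
  by_contra hne'
  have h1 : P.support.inf (fun d => ((d.degree : ℕ) : ℕ∞)) ≤ d.degree :=
    Finset.inf_le (f := fun d : σ →₀ ℕ => ((d.degree : ℕ) : ℕ∞)) (MvPolynomial.mem_support_iff.mpr hne')
  rw [hmin] at h1
  exact absurd (by exact_mod_cast h1) (not_le.mpr hd)

/-- `ord₀ P ≥ n` iff every monomial of `P` has degree `≥ n`. [folklore] -/
theorem natCast_le_ordZero_iff (P : MvPolynomial σ K) (n : ℕ) :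
    (n : ℕ∞) ≤ ordZero P ↔ ∀ d ∈ P.support, n ≤ d.degree := by
  rw [ordZero_eq_inf_support, Finset.le_inf_iff]
  exact forall₂_congr fun d _ => by exact_mod_cast Iff.rfl

/-- `ord₀ P ≤ |d|` for every monomial `x^d` of `P`. [folklore] -/
theorem ordZero_le_degree_of_mem_support {P : MvPolynomial σ K} {d : σ →₀ ℕ} (hd : d ∈ P.support) :
    ordZero P ≤ d.degree := by
  rw [ordZero_eq_inf_support]
  exact Finset.inf_le (f := fun d : σ →₀ ℕ => ((d.degree : ℕ) : ℕ∞)) hd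

/-- Multiplication by a non-zero natural number commutes with finite infima in `ℕ∞`. [folklore] -/
theorem natCast_mul_finset_inf {ι : Type*} (s : Finset ι) (f : ι → ℕ∞) {p : ℕ} (hp : p ≠ 0) :
    (p : ℕ∞) * s.inf f = s.inf fun i => (p : ℕ∞) * f i := by
  refine Finset.apply_inf_eq_inf_comp (fun x : ℕ∞ => (p : ℕ∞) * x) (fun x y => ?_) ?_
  · have hmono : Monotone fun x : ℕ∞ => (p : ℕ∞) * x := fun a b h =>
      mul_le_mul_of_nonneg_left h bot_le
    exact hmono.map_inf x y
  · exact ENat.mul_top (by exact_mod_cast hp)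

/-- `(p · x).toNat = p · x.toNat` in `ℕ∞`. [folklore] -/
theorem toNat_natCast_mul (p : ℕ) (x : ℕ∞) (hp : p ≠ 0) : ((p : ℕ∞) * x).toNat = p * x.toNat := by
  induction x using ENat.recTopCoe with
  | top => rw [ENat.mul_top (by exact_mod_cast hp)]; simp
  | coe n => norm_cast

end OrdInf

/-! ## Reach in the exponent `e`: the Frobenius twist `F ↦ F(x₁ᵖ, …, xₙᵖ)`

`MvPolynomial.expand p` multiplies every exponent by `p`. Over a ring of characteristic `p` it
commutes with the point blow-up (after taking `p`-th roots of the translations), with cleaning and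
with the division by the exceptional monomial, and multiplies `ord`, `ord_{(xᵢ)}` and the residual
order by `p`; so a divergent point blow-up sequence for `ord f = q` yields one for `ord f = p·q`. -/

section Expand

variable {σ : Type*} {K : Type*} [CommRing K] {p : ℕ}

/-- `x^{p·d}` is a `(p·q)`-th power monomial iff `x^d` is a `q`-th power monomial. [folklore] -/
theorem isPthPowerExponent_smul_iff (hp : p ≠ 0) (q : ℕ) (d : σ →₀ ℕ) :
    IsPthPowerExponent (p * q) (p • d) ↔ IsPthPowerExponent q d := by
  rw [isPthPowerExponent_iff, isPthPowerExponent_iff]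
  simp only [Finsupp.smul_apply, smul_eq_mul]
  exact forall_congr' fun i => Nat.mul_dvd_mul_iff_left (Nat.pos_of_ne_zero hp)

/-- An exponent all of whose entries are divisible by `p` is `p • d'`. [folklore] -/
theorem exists_eq_smul_of_forall_dvd {m : σ →₀ ℕ} (h : ∀ i, p ∣ m i) :
    ∃ m' : σ →₀ ℕ, m = p • m' :=
  ⟨m.mapRange (· / p) (Nat.zero_div p), by
    ext i
    simp only [Finsupp.smul_apply, Finsupp.mapRange_apply, smul_eq_mul]
    exact (Nat.mul_div_cancel' (h i)).symm⟩

/-- The twist of a clean `F` is clean (for `p·q`). [cite: HauserPerlega2019, §2 (clean)] -/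
theorem isClean_expand [DecidableEq σ] (hp : p ≠ 0) {q : ℕ} {F : MvPolynomial σ K}
    (h : IsClean q F) : IsClean (p * q) (expand p F) := by
  intro d hd
  rw [support_expand F hp, Finset.mem_image] at hd
  obtain ⟨d₀, hd₀, rfl⟩ := hd
  rw [isPthPowerExponent_smul_iff hp]
  exact h d₀ hd₀

/-- The twist commutes with cleaning. [cite: HauserPerlega2019, §2 (cleaning)] -/
theorem deletePthPowers_expand [DecidableEq σ] (hp : p ≠ 0) (q : ℕ) (F : MvPolynomial σ K) :
    deletePthPowers (p * q) (expand p F) = expand p (deletePthPowers q F) := by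
  ext m
  rw [coeff_deletePthPowers]
  by_cases h : ∀ i, p ∣ m i
  · obtain ⟨m', rfl⟩ := exists_eq_smul_of_forall_dvd h
    rw [coeff_expand_smul p hp, coeff_expand_smul p hp, coeff_deletePthPowers]
    simp only [isPthPowerExponent_smul_iff hp]
  · push Not at h
    obtain ⟨i, hi⟩ := h
    rw [coeff_expand_of_not_dvd _ hi, coeff_expand_of_not_dvd _ hi, ite_self]

/-- The twist commutes with division by a (twisted) monomial. [folklore] -/
theorem divMonomial_expand [DecidableEq σ] (hp : p ≠ 0) (F : MvPolynomial σ K) (s : σ →₀ ℕ) :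
    MvPolynomial.divMonomial (expand p F) (p • s) = expand p (MvPolynomial.divMonomial F s) := by
  ext m
  rw [coeff_divMonomial]
  by_cases h : ∀ i, p ∣ m i
  · obtain ⟨m', rfl⟩ := exists_eq_smul_of_forall_dvd h
    rw [← smul_add, coeff_expand_smul p hp, coeff_expand_smul p hp, coeff_divMonomial]
  · push Not at h
    obtain ⟨i, hi⟩ := h
    have hi' : ¬ p ∣ (p • s + m) i := by
      rw [Finsupp.add_apply, Finsupp.smul_apply, smul_eq_mul]
      exact fun h' => hi ((Nat.dvd_add_right (dvd_mul_right p (s i))).mp h')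
    rw [coeff_expand_of_not_dvd _ hi', coeff_expand_of_not_dvd _ hi]

/-- `ord (F(xᵖ)) = p · ord F`. [folklore] -/
theorem ordZero_expand [DecidableEq σ] (hp : p ≠ 0) (F : MvPolynomial σ K) :
    ordZero (expand p F) = p * ordZero F := by
  rw [ordZero_eq_inf_support, ordZero_eq_inf_support, support_expand F hp, Finset.inf_image,
    natCast_mul_finset_inf _ _ hp]
  refine Finset.inf_congr rfl fun d _ => ?_
  simp only [Function.comp_apply, map_nsmul, smul_eq_mul, Nat.cast_mul]

/-- `ord_{(xᵢ)} (F(xᵖ)) = p · ord_{(xᵢ)} F`. [folklore] -/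
theorem ordAlong_expand [DecidableEq σ] (hp : p ≠ 0) (i : σ) (F : MvPolynomial σ K) :
    ordAlong i (expand p F) = p * ordAlong i F := by
  unfold ordAlong
  rw [support_expand F hp, Finset.inf_image, natCast_mul_finset_inf _ _ hp]
  refine Finset.inf_congr rfl fun d _ => ?_
  simp only [Function.comp_apply, Finsupp.smul_apply, smul_eq_mul, Nat.cast_mul]

/-- The exceptional exponent of the twist is `p` times the exceptional exponent. [folklore] -/
theorem exceptionalExp_expand [DecidableEq σ] (hp : p ≠ 0) (Δ : Finset σ) (F : MvPolynomial σ K) :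
    exceptionalExp Δ (expand p F) = p • exceptionalExp Δ F := by
  unfold exceptionalExp
  rw [Finset.smul_sum]
  refine Finset.sum_congr rfl fun i _ => ?_
  rw [ordAlong_expand hp, toNat_natCast_mul p _ hp, smul_smul]

/-- The residual factor of the twist is the twist of the residual factor. [folklore] -/
theorem residualFactor_expand [DecidableEq σ] (hp : p ≠ 0) (Δ : Finset σ) (F : MvPolynomial σ K) :
    residualFactor Δ (expand p F) = expand p (residualFactor Δ F) := by
  unfold residualFactor
  rw [exceptionalExp_expand hp, divMonomial_expand hp]

/-- **The residual order of `F(xᵖ)` is `p` times that of `F`** (same exceptional set).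
[cite: HauserPerlega2019, §2 (residual order)] -/
theorem residualOrder_expand [DecidableEq σ] (hp : p ≠ 0) (Δ : Finset σ) (F : MvPolynomial σ K) :
    residualOrder Δ (expand p F) = p * residualOrder Δ F := by
  unfold residualOrder
  rw [residualFactor_expand hp, ordZero_expand hp]

/-- **The twist commutes with the point blow-up up to `p`-th roots of the translations**:
`π_{t'}(F(xᵖ)) = (π_t F)(xᵖ)` when `t'ᵢᵖ = tᵢ`, by `(xᵢ + c)ᵖ = xᵢᵖ + cᵖ` in characteristic `p`.
[cite: HauserPerlega2019, §2 (point blowup)] -/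
theorem totalTransform_expand [DecidableEq σ] [Fact p.Prime] [CharP K p] (j : σ) {t t' : σ → K}
    (ht : ∀ i, t' i ^ p = t i) (F : MvPolynomial σ K) :
    totalTransform j t' (expand p F) = expand p (totalTransform j t F) := by
  unfold totalTransform
  rw [aeval_expand, ← AlgHom.comp_apply, comp_aeval]
  have : CharP (MvPolynomial σ K) p := inferInstance
  have hfg : (pointBlowupSubst j t' ^ p) = fun i => expand p (pointBlowupSubst j t i) := by
    funext i
    unfold pointBlowupSubst
    by_cases hij : i = j
    · simp [hij, expand_X]
    · simp only [hij, if_false, Pi.pow_apply, map_mul, map_add, expand_X, expand_C]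
      rw [mul_pow, add_pow_char, ← map_pow, ht]
  rw [hfg]

/-- The twist commutes with `F ↦ x_j^{−q} π(F)` (`q ↦ p·q`, translations ↦ `p`-th roots).
[cite: HauserPerlega2019, §2 (`F' = x_j^{−pᵉ} π(F)`)] -/
theorem transformResidual_expand [DecidableEq σ] [Fact p.Prime] [CharP K p] (q : ℕ) (j : σ)
    {t t' : σ → K} (ht : ∀ i, t' i ^ p = t i) (F : MvPolynomial σ K) :
    transformResidual (p * q) j t' (expand p F) = expand p (transformResidual q j t F) := by
  unfold transformResidual
  have hp : p ≠ 0 := (Fact.out : p.Prime).ne_zero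
  rw [totalTransform_expand j ht, show Finsupp.single j (p * q) = p • Finsupp.single j q by
    rw [Finsupp.smul_single, smul_eq_mul], divMonomial_expand hp]

/-- The new exceptional set only depends on which translations vanish. [cite: HauserPerlega2019, §2 (the set B)] -/
theorem newExceptional_congr [DecidableEq σ] (Δ : Finset σ) (j : σ) {t t' : σ → K}
    (h : ∀ i, t i = 0 ↔ t' i = 0) : newExceptional Δ j t = newExceptional Δ j t' := by
  classical
  ext i
  simp only [newExceptional, Finset.mem_insert, Finset.mem_filter, h i]

/-- **A point blow-up sequence for `ord f = q` twists into one for `ord f = p·q`** (translations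
replaced by `p`-th roots). [cite: HauserPerlega2019, §2] -/
theorem IsPointBlowupSequence.expand [DecidableEq σ] [Fact p.Prime] [CharP K p] [NoZeroDivisors K]
    {q : ℕ} {F : ℕ → MvPolynomial σ K} {Δ : ℕ → Finset σ} {j : ℕ → σ} {t t' : ℕ → σ → K}
    (h : IsPointBlowupSequence q F Δ j t) (ht : ∀ k i, t' k i ^ p = t k i) :
    IsPointBlowupSequence (p * q) (fun k => MvPolynomial.expand p (F k)) Δ j t' where
  clean k := isClean_expand (Fact.out : p.Prime).ne_zero (h.clean k)
  ord_le k := by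
    have hp : p ≠ 0 := (Fact.out : p.Prime).ne_zero
    rw [ordZero_expand hp, Nat.cast_mul]
    exact mul_le_mul_of_nonneg_left (h.ord_le k) bot_le
  transform k := by
    rw [h.transform k, transformResidual_expand q (j k) (ht k), deletePthPowers_expand
      (Fact.out : p.Prime).ne_zero]
  exceptional k := by
    rw [h.exceptional k]
    refine newExceptional_congr _ _ fun i => ?_
    rw [← ht k i]
    exact pow_eq_zero_iff (Fact.out : p.Prime).ne_zero

/-- **Reach in `e`: one step.** Over a field of characteristic `p` with `p`-th roots, a divergent
point blow-up sequence for `ord f = pᵉ` yields one for `ord f = p^{e+1}` (the residual orders are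
multiplied by `p`). [cite: HauserPerlega2019, §1 (main statement)] -/
theorem HasDivergentPointBlowupSequence.exp_succ {p e n : ℕ} {K : Type} [Field K] [CharP K p]
    (hp : p.Prime) (hroot : ∀ x : K, ∃ y : K, y ^ p = x)
    (h : HasDivergentPointBlowupSequence p e n K) :
    HasDivergentPointBlowupSequence p (e + 1) n K := by
  haveI := Fact.mk hp
  obtain ⟨F, Δ, j, t, hseq, ⟨d, hd⟩, hinf⟩ := h
  choose r hr using hroot
  refine ⟨fun k => MvPolynomial.expand p (F k), Δ, j, fun k i => r (t k i), ?_, ?_, ?_⟩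
  · rw [pow_succ, mul_comm]
    exact hseq.expand fun k i => hr _
  · refine ⟨p * d, ?_⟩
    dsimp only
    rw [residualOrder_expand hp.ne_zero, hd, Nat.cast_mul]
  · intro N
    obtain ⟨k₀, hk₀⟩ := hinf N
    refine ⟨k₀, fun k hk => lt_of_lt_of_le (hk₀ k hk) ?_⟩
    dsimp only
    rw [residualOrder_expand hp.ne_zero]
    exact le_mul_of_one_le_left bot_le (by exact_mod_cast hp.one_lt.le)

/-- **Reach in `e`.** Over an algebraically closed field of characteristic `p`, divergence for
`ord f = pᵉ` gives divergence for every `ord f = p^{e'}`, `e' ≥ e`. [cite: HauserPerlega2019, §3 ("in the case e ≥ 3")] -/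
theorem HasDivergentPointBlowupSequence.of_exp_le {p e e' n : ℕ} {K : Type} [Field K]
    [IsAlgClosed K] [CharP K p] (hp : p.Prime) (hle : e ≤ e')
    (h : HasDivergentPointBlowupSequence p e n K) : HasDivergentPointBlowupSequence p e' n K := by
  induction e', hle using Nat.le_induction with
  | base => exact h
  | succ e' _ ih => exact ih.exp_succ hp fun x => IsAlgClosed.exists_pow_nat_eq x hp.pos

end Expand

/-! ## Reach in the number of variables: idle variables

Renaming the variables along an injection `ι : σ ↪ τ` (the new variables never occur) commutes
with every construction of the §2 setting and preserves orders and residual orders; so a divergent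
point blow-up sequence in `n` variables is one in `n + 1` variables. -/

section Rename

variable {σ τ : Type*} {K : Type*} [CommRing K] {ι : σ → τ}

/-- An exponent vector on `τ` either comes from `σ` or involves a variable outside the range of `ι`.
[folklore] -/
theorem exists_eq_mapDomain_or (hι : Function.Injective ι) (e : τ →₀ ℕ) :
    (∃ d : σ →₀ ℕ, e = Finsupp.mapDomain ι d) ∨ ¬ (↑e.support ⊆ Set.range ι) := by
  by_cases h : (↑e.support ⊆ Set.range ι)
  · exact Or.inl ⟨_, (Finsupp.mapDomain_comapDomain ι hι e h).symm⟩
  · exact Or.inr h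

/-- Monomials of `rename ι P` only involve variables in the range of `ι`. [folklore] -/
theorem coeff_rename_eq_zero_of_not_subset [DecidableEq τ] {P : MvPolynomial σ K} {e : τ →₀ ℕ}
    (he : ¬ (↑e.support ⊆ Set.range ι)) : coeff e (rename ι P) = 0 := by
  apply coeff_rename_eq_zero
  intro u hu
  exfalso
  apply he
  rw [← hu]
  intro l hl
  have hl' := Finsupp.mapDomain_support (f := ι) (s := u) (Finset.mem_coe.mp hl)
  rw [Finset.mem_image] at hl'
  obtain ⟨i, -, rfl⟩ := hl'
  exact Set.mem_range_self i

/-- `q`-th power exponents are preserved by renaming. [folklore] -/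
theorem isPthPowerExponent_mapDomain_iff (hι : Function.Injective ι) (q : ℕ) (d : σ →₀ ℕ) :
    IsPthPowerExponent q (Finsupp.mapDomain ι d) ↔ IsPthPowerExponent q d := by
  rw [isPthPowerExponent_iff, isPthPowerExponent_iff]
  constructor
  · intro h i
    simpa [Finsupp.mapDomain_apply hι] using h (ι i)
  · intro h l
    by_cases hl : l ∈ Set.range ι
    · obtain ⟨i, rfl⟩ := hl
      rw [Finsupp.mapDomain_apply hι]
      exact h i
    · rw [Finsupp.mapDomain_notin_range _ _ hl]
      exact dvd_zero q

/-- Renaming commutes with cleaning. [folklore] -/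
theorem deletePthPowers_rename [DecidableEq σ] [DecidableEq τ] (hι : Function.Injective ι) (q : ℕ)
    (P : MvPolynomial σ K) :
    deletePthPowers q (rename ι P) = rename ι (deletePthPowers q P) := by
  ext e
  rw [coeff_deletePthPowers]
  rcases exists_eq_mapDomain_or hι e with ⟨d, rfl⟩ | he
  · rw [coeff_rename_mapDomain ι hι, coeff_rename_mapDomain ι hι, coeff_deletePthPowers]
    simp only [isPthPowerExponent_mapDomain_iff hι]
  · rw [coeff_rename_eq_zero_of_not_subset he, coeff_rename_eq_zero_of_not_subset he, ite_self]

/-- Renaming commutes with division by a (renamed) monomial. [folklore] -/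
theorem divMonomial_rename [DecidableEq τ] (hι : Function.Injective ι) (P : MvPolynomial σ K)
    (s : σ →₀ ℕ) :
    MvPolynomial.divMonomial (rename ι P) (Finsupp.mapDomain ι s) =
      rename ι (MvPolynomial.divMonomial P s) := by
  ext e
  rw [coeff_divMonomial]
  rcases exists_eq_mapDomain_or hι e with ⟨d, rfl⟩ | he
  · rw [← Finsupp.mapDomain_add, coeff_rename_mapDomain ι hι, coeff_rename_mapDomain ι hι,
      coeff_divMonomial]
  · rw [coeff_rename_eq_zero_of_not_subset he, coeff_rename_eq_zero_of_not_subset]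
    intro hsub
    apply he
    intro l hl
    apply hsub
    rw [Finset.mem_coe, Finsupp.mem_support_iff] at hl ⊢
    rw [Finsupp.add_apply]
    omega

/-- Renaming the point blow-up substitution (translations extended anyhow off the range).
[folklore] -/
theorem rename_pointBlowupSubst_of_injective [DecidableEq σ] [DecidableEq τ]
    (hι : Function.Injective ι) (j : σ) (t : σ → K) (t' : τ → K) (ht : ∀ i, t' (ι i) = t i) (i : σ) :
    rename ι (pointBlowupSubst j t i) = pointBlowupSubst (ι j) t' (ι i) := by
  unfold pointBlowupSubst
  by_cases hij : i = j
  · subst hij; simp [rename_X]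
  · have : ι i ≠ ι j := fun h => hij (hι h)
    simp [hij, this, rename_X, map_mul, map_add, ht]

/-- Renaming commutes with the total transform. [folklore] -/
theorem totalTransform_rename [DecidableEq σ] [DecidableEq τ] (hι : Function.Injective ι) (j : σ)
    (t : σ → K) (t' : τ → K) (ht : ∀ i, t' (ι i) = t i) (F : MvPolynomial σ K) :
    totalTransform (ι j) t' (rename ι F) = rename ι (totalTransform j t F) := by
  unfold totalTransform
  rw [aeval_rename, ← AlgHom.comp_apply, comp_aeval]
  have : (fun i => rename ι (pointBlowupSubst j t i)) = pointBlowupSubst (ι j) t' ∘ ι :=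
    funext fun i => rename_pointBlowupSubst_of_injective hι j t t' ht i
  rw [this]

/-- Renaming commutes with `F ↦ x_j^{−q} π(F)`. [folklore] -/
theorem transformResidual_rename [DecidableEq σ] [DecidableEq τ] (hι : Function.Injective ι)
    (q : ℕ) (j : σ) (t : σ → K) (t' : τ → K) (ht : ∀ i, t' (ι i) = t i) (F : MvPolynomial σ K) :
    transformResidual q (ι j) t' (rename ι F) = rename ι (transformResidual q j t F) := by
  unfold transformResidual
  rw [totalTransform_rename hι j t t' ht, ← Finsupp.mapDomain_single (f := ι), divMonomial_rename hι]

/-- Renaming the new exceptional set. [folklore] -/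
theorem newExceptional_image [DecidableEq σ] [DecidableEq τ] (hι : Function.Injective ι)
    (Δ : Finset σ) (j : σ) (t : σ → K) (t' : τ → K) (ht : ∀ i, t' (ι i) = t i) :
    newExceptional (Δ.image ι) (ι j) t' = (newExceptional Δ j t).image ι := by
  classical
  ext l
  simp only [newExceptional, Finset.mem_insert, Finset.mem_filter, Finset.mem_image]
  constructor
  · rintro (rfl | ⟨⟨i, hi, rfl⟩, hne, ht0⟩)
    · exact ⟨j, Or.inl rfl, rfl⟩
    · exact ⟨i, Or.inr ⟨hi, fun h => hne (congrArg ι h), by rwa [ht] at ht0⟩, rfl⟩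
  · rintro ⟨i, rfl | ⟨hi, hne, ht0⟩, rfl⟩
    · exact Or.inl rfl
    · exact Or.inr ⟨⟨i, hi, rfl⟩, fun h => hne (hι h), by rwa [ht]⟩

/-- `ord` is invariant under renaming. [folklore] -/
theorem ordZero_rename [DecidableEq τ] (hι : Function.Injective ι) (P : MvPolynomial σ K) :
    ordZero (rename ι P) = ordZero P := by
  rw [ordZero_eq_inf_support, ordZero_eq_inf_support, support_rename_of_injective hι,
    Finset.inf_image]
  refine Finset.inf_congr rfl fun d _ => ?_
  simp only [Function.comp_apply, Finsupp.degree_mapDomain]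

/-- `ord_{(x_{ι i})}` of the renamed polynomial is `ord_{(xᵢ)}`. [folklore] -/
theorem ordAlong_rename [DecidableEq τ] (hι : Function.Injective ι) (i : σ) (P : MvPolynomial σ K) :
    ordAlong (ι i) (rename ι P) = ordAlong i P := by
  unfold ordAlong
  rw [support_rename_of_injective hι, Finset.inf_image]
  refine Finset.inf_congr rfl fun d _ => ?_
  simp only [Function.comp_apply, Finsupp.mapDomain_apply hι]

/-- The exceptional exponent of the renamed polynomial (exceptional set renamed). [folklore] -/
theorem exceptionalExp_image [DecidableEq σ] [DecidableEq τ] (hι : Function.Injective ι)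
    (Δ : Finset σ) (P : MvPolynomial σ K) :
    exceptionalExp (Δ.image ι) (rename ι P) = Finsupp.mapDomain ι (exceptionalExp Δ P) := by
  unfold exceptionalExp
  rw [Finset.sum_image fun i _ l _ h => hι h, Finsupp.mapDomain_finsetSum]
  refine Finset.sum_congr rfl fun i _ => ?_
  rw [ordAlong_rename hι, Finsupp.mapDomain_smul, Finsupp.mapDomain_single]

/-- The residual factor of the renamed polynomial. [folklore] -/
theorem residualFactor_rename [DecidableEq σ] [DecidableEq τ] (hι : Function.Injective ι)
    (Δ : Finset σ) (P : MvPolynomial σ K) :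
    residualFactor (Δ.image ι) (rename ι P) = rename ι (residualFactor Δ P) := by
  unfold residualFactor
  rw [exceptionalExp_image hι, divMonomial_rename hι]

/-- **The residual order is invariant under renaming into more variables.**
[cite: HauserPerlega2019, §2 (residual order)] -/
theorem residualOrder_rename [DecidableEq σ] [DecidableEq τ] (hι : Function.Injective ι)
    (Δ : Finset σ) (P : MvPolynomial σ K) :
    residualOrder (Δ.image ι) (rename ι P) = residualOrder Δ P := by
  unfold residualOrder
  rw [residualFactor_rename hι, ordZero_rename hι]

/-- Cleanness is invariant under renaming. [folklore] -/
theorem isClean_rename [DecidableEq τ] (hι : Function.Injective ι) {q : ℕ} {F : MvPolynomial σ K}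
    (h : IsClean q F) : IsClean q (rename ι F) := by
  intro e he
  rw [support_rename_of_injective hι, Finset.mem_image] at he
  obtain ⟨d, hd, rfl⟩ := he
  rw [isPthPowerExponent_mapDomain_iff hι]
  exact h d hd

/-- **A point blow-up sequence stays one after renaming into more variables.**
[cite: HauserPerlega2019, §2] -/
theorem IsPointBlowupSequence.rename [DecidableEq σ] [DecidableEq τ] (hι : Function.Injective ι)
    {q : ℕ} {F : ℕ → MvPolynomial σ K} {Δ : ℕ → Finset σ} {j : ℕ → σ} {t : ℕ → σ → K}
    (h : IsPointBlowupSequence q F Δ j t) (t' : ℕ → τ → K) (ht : ∀ k i, t' k (ι i) = t k i) :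
    IsPointBlowupSequence q (fun k => MvPolynomial.rename ι (F k)) (fun k => (Δ k).image ι)
      (fun k => ι (j k)) t' where
  clean k := isClean_rename hι (h.clean k)
  ord_le k := by rw [ordZero_rename hι]; exact h.ord_le k
  transform k := by
    rw [h.transform k, transformResidual_rename hι q (j k) (t k) (t' k) (ht k),
      deletePthPowers_rename hι]
  exceptional k := by
    rw [h.exceptional k, newExceptional_image hι (Δ k) (j k) (t k) (t' k) (ht k)]

/-- **Reach in `n`: one idle variable.** [cite: HauserPerlega2019, §1 (main statement)] -/
theorem HasDivergentPointBlowupSequence.vars_succ {p e n : ℕ} {K : Type} [Field K]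
    (h : HasDivergentPointBlowupSequence p e n K) :
    HasDivergentPointBlowupSequence p e (n + 1) K := by
  obtain ⟨F, Δ, j, t, hseq, ⟨d, hd⟩, hinf⟩ := h
  have hι : Function.Injective (Fin.castSucc : Fin n → Fin (n + 1)) := Fin.castSucc_injective n
  refine ⟨fun k => MvPolynomial.rename Fin.castSucc (F k), fun k => (Δ k).image Fin.castSucc,
    fun k => Fin.castSucc (j k), fun k => Fin.snoc (t k) 0, ?_, ?_, ?_⟩
  · exact hseq.rename hι _ fun k i => Fin.snoc_castSucc _ _ _
  · exact ⟨d, by dsimp only; rw [residualOrder_rename hι, hd]⟩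
  · intro N
    obtain ⟨k₀, hk₀⟩ := hinf N
    exact ⟨k₀, fun k hk => by dsimp only; rw [residualOrder_rename hι]; exact hk₀ k hk⟩

/-- **Reach in `n`.** [cite: HauserPerlega2019, §1 (main statement)] -/
theorem HasDivergentPointBlowupSequence.of_vars_le {p e n n' : ℕ} {K : Type} [Field K]
    (hle : n ≤ n') (h : HasDivergentPointBlowupSequence p e n K) :
    HasDivergentPointBlowupSequence p e n' K := by
  induction n', hle using Nat.le_induction with
  | base => exact h
  | succ n' _ ih => exact ih.vars_succ

end Rename

/-! ## Permissible coordinate centres (Hauser–Perlega §2) -/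

section Permissible

variable {σ : Type*} {K : Type*} [CommRing K]

/-- **Permissible coordinate centre.** In the §2 setting (`f = z^q + F(x)` with `F` clean,
exceptional set `Δ`, residual factor `G`, residual order `d`) the ideal `P = (z, xᵢ : i ∈ Γ)`,
`Γ ⊆ {1, …, n}`, "is said to define a permissible center of blowup for `f` and `E`" if
"(1) `f ∈ P^{pᵉ}`" and "(2) `G ∈ P^d`" [cite: HauserPerlega2019, §2]. For the coordinate ideal `P`
one has `z^q ∈ P^q`, and a polynomial in `x` lies in `P^m` iff each of its monomials `x^d` has
`Γ`-degree `Σ_{i∈Γ} dᵢ ≥ m`; this is the rendering. `Γ = univ` is the closed point (the centre of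
`pointBlowupSubst`); `|Γ| = c` gives the regular centre `V(z, xᵢ : i ∈ Γ)` of codimension `c + 1`.
[cite: HauserPerlega2019, §2 (permissible center)] -/
def IsPermissibleCentre (q : ℕ) (Δ Γ : Finset σ) (F : MvPolynomial σ K) : Prop :=
  (∀ d ∈ F.support, q ≤ ∑ i ∈ Γ, d i) ∧
    ∀ d ∈ (residualFactor Δ F).support, residualOrder Δ F ≤ ((∑ i ∈ Γ, d i : ℕ) : ℕ∞)

/-- **"The maximal ideal `(z, x₁, …, xₙ)` always defines a permissible center"** — as soon as
`ord F ≥ q` (i.e. `ord f = q`), for every exceptional set. [cite: HauserPerlega2019, §2] -/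
theorem isPermissibleCentre_univ [Fintype σ] {q : ℕ} (Δ : Finset σ) {F : MvPolynomial σ K}
    (hF : (q : ℕ∞) ≤ ordZero F) : IsPermissibleCentre q Δ Finset.univ F := by
  refine ⟨fun d hd => ?_, fun d hd => ?_⟩
  · rw [← Finsupp.degree_eq_sum]
    exact (natCast_le_ordZero_iff F q).mp hF d hd
  · rw [← Finsupp.degree_eq_sum]
    exact ordZero_le_degree_of_mem_support hd

end Permissible

/-! ## Hauser–Perlega's first example: the point centre is a choice from the start -/

namespace Example1

variable (K : Type*) [CommRing K]

/-- `G⁰ = w² + x³u¹⁰`, the residual factor of `F⁰ = x⁴y⁴w⁶ · G⁰` w.r.t. `E = V(xyuvw)`.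
[cite: HauserPerlega2019, §4 First example (0) (`d = 2`, `λ = 1`, `Q = 0`, `A = 1`)] -/
def G0 : MvPolynomial (Fin 5) K := monomial (V 0 0 0 0 2) 1 + monomial (V 3 0 10 0 0) 1

variable {K}

/-- `F⁰ = x⁴y⁴w⁶ · G⁰`. [cite: HauserPerlega2019, §4 First example (0)] -/
theorem F0_eq_monomial_mul_G0 : F0 K = monomial (V 4 4 0 0 6) 1 * G0 K := by
  simp only [F0, G0, mul_add, monomial_mul, one_mul, V_add_V]

/-- Coefficients of `G⁰`. [folklore] -/
theorem coeff_G0 [Nontrivial K] (e : Fin 5 →₀ ℕ) :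
    coeff e (G0 K) = (if V 0 0 0 0 2 = e then 1 else 0) + (if V 3 0 10 0 0 = e then 1 else 0) := by
  simp only [G0, coeff_add, coeff_monomial]

/-- The monomials of `F⁰`. [folklore] -/
theorem mem_support_F0 [Nontrivial K] {e : Fin 5 →₀ ℕ} (he : e ∈ (F0 K).support) :
    e = V 4 4 0 0 8 ∨ e = V 7 4 10 0 6 := by
  rw [MvPolynomial.mem_support_iff, coeff_F0] at he
  by_cases h1 : V 4 4 0 0 8 = e
  · exact Or.inl h1.symm
  by_cases h2 : V 7 4 10 0 6 = e
  · exact Or.inr h2.symm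
  simp [h1, h2] at he

/-- The monomials of `G⁰`. [folklore] -/
theorem mem_support_G0 [Nontrivial K] {e : Fin 5 →₀ ℕ} (he : e ∈ (G0 K).support) :
    e = V 0 0 0 0 2 ∨ e = V 3 0 10 0 0 := by
  rw [MvPolynomial.mem_support_iff, coeff_G0] at he
  by_cases h1 : V 0 0 0 0 2 = e
  · exact Or.inl h1.symm
  by_cases h2 : V 3 0 10 0 0 = e
  · exact Or.inr h2.symm
  simp [h1, h2] at he

/-- `x⁴y⁴w⁸` occurs in `F⁰`. [folklore] -/
theorem V44008_mem_support_F0 [Nontrivial K] : V 4 4 0 0 8 ∈ (F0 K).support := by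
  rw [MvPolynomial.mem_support_iff, coeff_F0]; simp [eq_V_iff]

/-- `x⁷y⁴u¹⁰w⁶` occurs in `F⁰`. [folklore] -/
theorem V741006_mem_support_F0 [Nontrivial K] : V 7 4 10 0 6 ∈ (F0 K).support := by
  rw [MvPolynomial.mem_support_iff, coeff_F0]; simp [eq_V_iff]

/-- `ord_{(xᵢ)} F⁰` in coordinates: `(4, 4, 0, 0, 6)`. [cite: HauserPerlega2019, §4 First example (0)] -/
theorem ordAlong_F0 [Nontrivial K] (i : Fin 5) : ordAlong i (F0 K) = (V 4 4 0 0 6 i : ℕ) := by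
  rw [ordAlong_eq_natCast_iff]
  refine ⟨?_, fun d hd => ?_⟩
  · fin_cases i
    · exact ⟨V 4 4 0 0 8, MvPolynomial.mem_support_iff.mp V44008_mem_support_F0, rfl⟩
    · exact ⟨V 4 4 0 0 8, MvPolynomial.mem_support_iff.mp V44008_mem_support_F0, rfl⟩
    · exact ⟨V 4 4 0 0 8, MvPolynomial.mem_support_iff.mp V44008_mem_support_F0, rfl⟩
    · exact ⟨V 4 4 0 0 8, MvPolynomial.mem_support_iff.mp V44008_mem_support_F0, rfl⟩
    · exact ⟨V 7 4 10 0 6, MvPolynomial.mem_support_iff.mp V741006_mem_support_F0, rfl⟩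
  · rcases mem_support_F0 (MvPolynomial.mem_support_iff.mpr hd) with rfl | rfl <;>
      fin_cases i <;> simp

/-- The exceptional monomial of `F⁰` w.r.t. `E = V(xyuvw)` is `x⁴y⁴w⁶`.
[cite: HauserPerlega2019, §4 First example (0)] -/
theorem exceptionalExp_F0 [Nontrivial K] : exceptionalExp Finset.univ (F0 K) = V 4 4 0 0 6 := by
  ext i
  rw [exceptionalExp_apply_eq_toNat_of_mem (F0 K) (Finset.mem_univ i), ordAlong_F0, ENat.toNat_coe]

/-- The residual factor of `F⁰` is `G⁰ = w² + x³u¹⁰`. [cite: HauserPerlega2019, §4 First example (0)] -/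
theorem residualFactor_F0 [Nontrivial K] : residualFactor Finset.univ (F0 K) = G0 K := by
  rw [residualFactor, exceptionalExp_F0, F0_eq_monomial_mul_G0, divMonomial_monomial_mul]

/-- `ord G⁰ = 2`. [cite: HauserPerlega2019, §4 First example (0)] -/
theorem ordZero_G0 [Nontrivial K] : ordZero (G0 K) = 2 := by
  rw [show (2 : ℕ∞) = ((2 : ℕ) : ℕ∞) from rfl, ordZero_eq_nat_iff]
  refine ⟨⟨V 0 0 0 0 2, ?_, by simp⟩, fun d hd => ?_⟩
  · rw [coeff_G0]; simp [eq_V_iff]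
  · by_contra hne
    rcases mem_support_G0 (MvPolynomial.mem_support_iff.mpr hne) with rfl | rfl <;> simp at hd

/-- **"The residual order equals `d`" `= 2`** for the starting polynomial w.r.t. `E = V(xyuvw)`.
[cite: HauserPerlega2019, §4 First example (0)] -/
theorem residualOrder_F0 [Nontrivial K] : residualOrder Finset.univ (F0 K) = 2 := by
  rw [residualOrder, residualFactor_F0, ordZero_G0]

/-- **The centre `P = (z, x, w)` (dimension `3` in `𝔸⁶`) is permissible for `f = z⁸ + F⁰`**:
every monomial of `F⁰` has `(x,w)`-degree `≥ 12 ≥ 8` and every monomial of `G⁰` has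
`(x,w)`-degree `≥ 2 = d`. [cite: HauserPerlega2019, §2 (permissible center) and §4 First example (0)] -/
theorem isPermissibleCentre_F0_xw [Nontrivial K] :
    IsPermissibleCentre 8 Finset.univ ({0, 4} : Finset (Fin 5)) (F0 K) := by
  refine ⟨fun d hd => ?_, fun d hd => ?_⟩
  · rcases mem_support_F0 hd with rfl | rfl <;> simp
  · rw [residualOrder_F0]
    rw [residualFactor_F0] at hd
    rcases mem_support_G0 hd with rfl | rfl
    · simp
    · simp; decide

/-- **The centre `P = (z, u, w)` (dimension `3` in `𝔸⁶`) is permissible for `f = z⁸ + F⁰`** as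
well. [cite: HauserPerlega2019, §2 (permissible center) and §4 First example (0)] -/
theorem isPermissibleCentre_F0_uw [Nontrivial K] :
    IsPermissibleCentre 8 Finset.univ ({2, 4} : Finset (Fin 5)) (F0 K) := by
  refine ⟨fun d hd => ?_, fun d hd => ?_⟩
  · rcases mem_support_F0 hd with rfl | rfl <;> simp
  · rw [residualOrder_F0]
    rw [residualFactor_F0] at hd
    rcases mem_support_G0 hd with rfl | rfl
    · simp
    · simp; decide

/-- But no curve `V(z, xᵢ : i ≠ l)`-complement… precisely: **no centre of dimension `4`, i.e. no
`Γ = {l}`, is permissible** (each variable alone has degree `< 8` in some monomial of `F⁰`), so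
`3` is the maximal dimension of a permissible coordinate centre at the start. [folklore] -/
theorem not_isPermissibleCentre_F0_singleton [Nontrivial K] (l : Fin 5) :
    ¬ IsPermissibleCentre 8 Finset.univ ({l} : Finset (Fin 5)) (F0 K) := by
  intro h
  fin_cases l
  · have := h.1 _ V44008_mem_support_F0; simp at this
  · have := h.1 _ V44008_mem_support_F0; simp at this
  · have := h.1 _ V44008_mem_support_F0; simp at this
  · have := h.1 _ V44008_mem_support_F0; simp at this
  · have := h.1 _ V741006_mem_support_F0; simp at this

/-- The sequence of the first example starts at `F⁰` with exceptional set `univ`. [folklore] -/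
theorem seq_zero : seq K 0 = F0 K := rfl

end Example1

/-! ## The narrowed barrier -/

/-- **NARROWED BARRIER `ResidualOrderUnboundedNarrow`** (barrier audit of
`ResidualOrderUnbounded.lean`, 2026-08-16). Three conjuncts, all PROVED
(`residualOrderUnboundedNarrow_holds`); the catalogued named fact `HauserPerlega2019` is
conjuncts (1)–(2) at `e = 3`, `n = 5` / `n = 4` (`hauserPerlega2019_of_narrow`). (1) REACH IN `e`
AND `n`, CHARACTERISTIC `2`: for every algebraically closed field of characteristic `2`, EVERY
`e ≥ 3` and EVERY `n ≥ 5` there is a point blow-up sequence of clean polynomials in `n` variables,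
`ord f = 2ᵉ` throughout, whose residual order tends to infinity — the source prints `e = 3, n = 5`;
the Frobenius twist `F ↦ F(x₁ᵖ, …, xₙᵖ)` (`HasDivergentPointBlowupSequence.exp_succ`: residual
orders multiplied by `p`, translations replaced by their `p`-th roots, `(xᵢ + c)ᵖ = xᵢᵖ + cᵖ`) and
idle variables (`HasDivergentPointBlowupSequence.vars_succ`) do the rest. (2) The same in every
odd characteristic `p` for `e ≥ 3`, `n ≥ 4`. (3) THE POINT CENTRES ARE A CHOICE FROM THE FIRST
BLOW-UP ON: over every field of characteristic `2`, Hauser–Perlega's starting polynomial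
`F⁰ = x⁴y⁴w⁶(w² + x³u¹⁰)` (residual order `2` w.r.t. `E = V(xyuvw)`) starts a divergent point
blow-up sequence (`Example1.seq`) AND admits, besides the closed point, the permissible centres
`P = (z, x, w)` and `P = (z, u, w)` of dimension `3` in `𝔸⁶` in the printed sense of §2
("(1) `f ∈ P^{pᵉ}`", "(2) `G ∈ P^d`"; `IsPermissibleCentre`), `3` being the largest dimension of a
permissible coordinate centre there; the divergent run blows up the point.

- technique_class: moh-stability-theorem eventual-bound-on-uncorrected-residual-order-uniform-over-all-permissible-centre-choices residual-order-bounded-along-arbitrary-point-blowup-sequences long-run-decrease-claimed-for-every-permissible-sequence purely-inseparable-order-p^e-with-e-at-least-3 (NARROWED from the parent block: `resolution-invariant`, `induction-on-invariant`, `shade`, `order-of-coefficient-ideal`, `cleaning`, `point-blowup-sequence`, `residual-order` are NOT covered as a whole — only claims that are uniform over the choice of permissible centres; `bounded-increase-of-invariant` in the ONE-blow-up sense is TRUE: "Then `ord F̄ ≤ d + p^{e−1}`" [cite: Moh1987, p. 966 (Stability Theorem)], "Moh was able to show in [Moh87] that the increase under a single blowup is bounded by `p^{e−1}`" [cite: HauserPerlega2019,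 §3], extended to arbitrary ideals as "the residual order of `J` increases at most by `c!/p`" [cite: HauserPerlega2019PRIMS, §1 (Theorem)]; what is refuted is only its iteration into an EVENTUAL bound)
- blocks: exactly: (i) Moh's Stability Theorem as printed — "successive permissible blow-ups will not increase `ord F̄` beyond the bound `d + p^{e−1}` (in fact, `d + pʳ`, see below) until it drops to `d` or less", `k` algebraically closed, blow-ups "along a residually rational valuation", exceptional multiplicities `0 ≤ mᵢ < pᵉ`, `(∏ xᵢ^{mᵢ}) F_d` not a `pᵉ`-th power [cite: Moh1987, pp. 966–967] — and with it every statement implying an EVENTUAL bound on, or a long-run decrease of, the uncorrected residual order of `z^{pᵉ} + F(x)` that is UNIFORM OVER THE CHOICE OF PERMISSIBLE CENTRES (equivalently: claimed along an arbitrary sequence of closed points at which `ord f` stays `pᵉ`), for EVERY `e ≥ 3` and every `n ≥ 5` (`p = 2`), `n ≥ 4` (`p` odd) — conjuncts (1)–(2), `mohStabilityClaim_false`; Hauser–Perlega print `e = 3` and say "This disproves Moh's claim in the case `e ≥ 3`" [cite: HauserPerlega2019, §3] — conjuncts (1)–(2) supply the twist that justifies "`≥`"; (ii) the proof-internal bound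 `d' ≤ [d/pʳ]·pʳ + pʳ` after ONE blow-up (parent theorem `hauserPerlega_mohProofBoundFails`). NOT blocked (conjunct (3) and the cited pages): (A) termination arguments for a STRATEGY whose centre is prescribed by the singularity — the permissible hull of the top locus of the invariant, a maximal-dimensional permissible centre, Encinas–Hauser's iterated coefficient ideals, characteristic-polyhedron strategies: the divergent runs blow up closed points although `3`-dimensional permissible centres exist from the start (conjunct (3)); "in the examples one could choose at various instances a larger center than a point and thus would end up with a different sequence of blowups for which the residual order need not tend to infinity", "Taking larger centers would prevent the phenomenon from happening. We were not able to construct examples with cycles where the choice of point centers is forced (e.g., because the singularities are isolated)" [cite: HauserPerlega2019, §1 and §3]; (B) the ONE-blow-up bound and any use of it that does not iterate it into an eventual bound (see technique_class); (C) `e ≤ 2`: "it is known to be valid for `e = 1`" [cite: HauserPerlega2019, §3], `e = 2` is OPEN — the twist moves divergence only upward in `e`; (D) FEWER variables than printed (`n ≤ 4` for `p = 2`, `n ≤ 3` for odd `p`; in particular all threefolds `z^{pᵉ} + F(x₁,x₂,x₃)`): idle variables move divergence only upward in `n`, and for surfaces corrected residual orders terminate for every `e` [cite: Perlega2020, Introduction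 §4] [cite: HauserWagner2014, §1]; (E) corrected or different invariants (bonus, flag-maximised residual order, `ω`, elimination algebras, idealistic filtrations) — not the subject of the source; (F) local uniformization: the first example's function field is rational (`ResidualOrderUnboundedExample1Rational.lean`, `hauserPerlega_example1_param`), so every valuation dominating the divergent run is uniformizable — "they do not constitute a counterexample to the existence of resolutions in positive characteristic" [cite: HauserPerlega2019, §3].
- because: (1)–(2): `expand p` multiplies `ord`, every `ord_{(xᵢ)}`, the exceptional exponent and the residual order by `p` (`ordZero_expand`, `exceptionalExp_expand`, `residualOrder_expand`), commutes with cleaning for `p·q` (`deletePthPowers_expand`, `isClean_expand`) and with the point blow-up once the translations are replaced by `p`-th roots (`totalTransform_expand`, by `(xᵢ + c)ᵖ = xᵢᵖ + cᵖ`), so `IsPointBlowupSequence q ↦ IsPointBlowupSequence (p·q)` (`IsPointBlowupSequence.expand`); renaming along `Fin n ↪ Fin (n+1)` changes no order (`residualOrder_rename`, `IsPointBlowupSequence.rename`); induction on `e` and `n` from the kernel-checked `e = 3` runs (`hasDivergentPointBlowupSequence_two`, `hasDivergentPointBlowupSequence_odd`). (3): `F⁰ = x⁴y⁴w⁸ +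 x⁷y⁴u¹⁰w⁶` has exceptional monomial `x⁴y⁴w⁶` (`exceptionalExp_F0`) and residual factor `G⁰ = w² + x³u¹⁰` of order `2` (`residualFactor_F0`, `residualOrder_F0`); both monomials of `F⁰` have `(x,w)`- and `(u,w)`-degree `≥ 8`, both monomials of `G⁰` have `(x,w)`- and `(u,w)`-degree `≥ 2 = d` (`isPermissibleCentre_F0_xw`, `isPermissibleCentre_F0_uw`), no single variable has degree `≥ 8` in both monomials of `F⁰` (`not_isPermissibleCentre_F0_singleton`), and `F⁰` starts the divergent run of `ResidualOrderUnboundedExample1Cycle.lean` [cite: HauserPerlega2019, §2 (permissible center) and §4 First example].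
- evasions_known: (A)–(F) under `blocks`; the parent block's (a)–(d). Status of (A): no strategy is known to keep the residual order bounded on these hypersurfaces either — (A) is an absence of obstruction, not a theorem; the unpublished §5 of the arXiv source of [cite: HauserPerlega2019, §4] remarks that the iterated-coefficient-ideal centre at the start of the second example would be `(z, v, w)` (not used here).
- scope_caveats: (a) permissibility is rendered for COORDINATE centres `P = (z, xᵢ : i ∈ Γ)` only, by the printed conditions (1) `f ∈ P^{pᵉ}` (⇔ every monomial of `F` has `Γ`-degree `≥ pᵉ`, `z^{pᵉ} ∈ P^{pᵉ}` being automatic) and (2) `G ∈ P^d` [cite: HauserPerlega2019, §2]; such centres are regular and meet `E` transversally by construction; (b) conjunct (3) concerns the STARTING equation of the first example only — that larger centres are available "at various instances" later is print, not formalised, and nothing is claimed for the second example; (c) conjuncts (1)–(2) are stated over algebraically closed fields (`p`-th roots of the translations are needed for the twist; the `e = 3` runs themselves are over the prime field); (d) the twisted hypersurfaces `z^{p^{e+1}} + F(xᵖ) = 0` are Frobenius-type pull-backs of the printed ones — legitimate members of the class "purely inseparable `z^{pᵉ} + F`, `ord F ≥ pᵉ`, `F` clean" over which Moh's statement and `MohStabilityClaim`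 quantify, not new geometry; (e) nothing here bears on the EXISTENCE of resolutions or of local uniformization; `e = 2` and the low-dimensional cases are open, not evaded.
- status: established-narrowed (all conjuncts proved in this file; parent statements unchanged)
[cite: HauserPerlega2019, §1–§4] [cite: Moh1987, pp. 966–967] [cite: HauserPerlega2019PRIMS, §1]
[cite: Perlega2020, Introduction §4] -/
def ResidualOrderUnboundedNarrow : Prop :=
  (∀ (K : Type) [Field K] [IsAlgClosed K] [CharP K 2] (e n : ℕ), 3 ≤ e → 5 ≤ n →
      HasDivergentPointBlowupSequence 2 e n K) ∧
  (∀ (p : ℕ) (K : Type) [Field K] [IsAlgClosed K] [CharP K p] (e n : ℕ), p.Prime → p ≠ 2 →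
      3 ≤ e → 4 ≤ n → HasDivergentPointBlowupSequence p e n K) ∧
  ∀ (K : Type) [Field K] [CharP K 2],
    ∃ (F : ℕ → MvPolynomial (Fin 5) K) (Δ : ℕ → Finset (Fin 5)) (j : ℕ → Fin 5)
      (t : ℕ → Fin 5 → K),
      IsPointBlowupSequence 8 F Δ j t ∧ residualOrder (Δ 0) (F 0) = 2 ∧
      TendsToInfinity (fun k => residualOrder (Δ k) (F k)) ∧
      IsPermissibleCentre 8 (Δ 0) Finset.univ (F 0) ∧
      IsPermissibleCentre 8 (Δ 0) {0, 4} (F 0) ∧ IsPermissibleCentre 8 (Δ 0) {2, 4} (F 0) ∧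
      ∀ l : Fin 5, ¬ IsPermissibleCentre 8 (Δ 0) {l} (F 0)

/-- **Proof of the narrowed barrier.** (1)–(2): the kernel-checked `e = 3` runs, twisted and
renamed; (3): the first example's run with the permissibility computations above.
[cite: HauserPerlega2019, §4] -/
theorem residualOrderUnboundedNarrow_holds : ResidualOrderUnboundedNarrow := by
  refine ⟨fun K _ _ _ e n he hn => ?_, fun p K _ _ _ e n hp hp2 he hn => ?_, fun K _ _ => ?_⟩
  · exact ((hasDivergentPointBlowupSequence_two K).of_exp_le Nat.prime_two he).of_vars_le hn
  · exact ((hasDivergentPointBlowupSequence_odd p K hp hp2).of_exp_le hp he).of_vars_le hn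
  · refine ⟨Example1.seq K, seqΔ Finset.univ Example1.jSched (Example1.tSched K),
      Example1.jSched, Example1.tSched K, ?_, ?_, ?_, ?_, ?_, ?_, ?_⟩
    · exact isPointBlowupSequence_seq _ Example1.isClean_F0 Example1.le_ordZero_seq
    · exact Example1.residualOrder_F0
    · intro N
      refine ⟨Example1.kStart N, fun k hk => ?_⟩
      have h1 := Example1.le_residualOrder_seq (K := K) k
        (seqΔ Finset.univ Example1.jSched (Example1.tSched K) k)
      have h2 := Example1.le_pos_fst hk
      refine lt_of_lt_of_le ?_ h1
      have : N < Example1.dOf (Example1.pos k).1 := by unfold Example1.dOf; omega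
      exact_mod_cast this
    · exact isPermissibleCentre_univ _ (Example1.le_ordZero_seq 0)
    · exact Example1.isPermissibleCentre_F0_xw
    · exact Example1.isPermissibleCentre_F0_uw
    · exact Example1.not_isPermissibleCentre_F0_singleton

/-- **The narrowed statement contains the catalogued one**: `HauserPerlega2019` is (1) at
`e = 3, n = 5` and (2) at `e = 3, n = 4`. [cite: HauserPerlega2019, §1 (main statement)] -/
theorem hauserPerlega2019_of_narrow (h : ResidualOrderUnboundedNarrow) : HauserPerlega2019 :=
  ⟨fun K _ _ _ => h.1 K 3 5 le_rfl le_rfl,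
    fun p K _ _ _ hp hp2 => h.2.1 p K 3 4 hp hp2 le_rfl le_rfl⟩

/-- **The gap is strict on the `e`-axis**: Moh's claim restricted to `e ≥ 3` is false for EACH such
`e` separately (not only for the universally quantified statement `MohStabilityClaim`).
[cite: HauserPerlega2019, §3 ("in the case e ≥ 3")] -/
theorem mohStability_fails_for_each_e {e : ℕ} (he : 3 ≤ e) (K : Type) [Field K] [IsAlgClosed K]
    [CharP K 2] :
    ∃ (F : ℕ → MvPolynomial (Fin 5) K) (Δ : ℕ → Finset (Fin 5)) (j : ℕ → Fin 5)
      (t : ℕ → Fin 5 → K), IsPointBlowupSequence (2 ^ e) F Δ j t ∧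
      ∃ k, residualOrder (Δ 0) (F 0) + ((2 ^ (e - 1) : ℕ) : ℕ∞) < residualOrder (Δ k) (F k) := by
  obtain ⟨F, Δ, j, t, hseq, ⟨d, hd⟩, hinf⟩ := residualOrderUnboundedNarrow_holds.1 K e 5 he le_rfl
  refine ⟨F, Δ, j, t, hseq, ?_⟩
  obtain ⟨k₀, hk₀⟩ := hinf (d + 2 ^ (e - 1))
  refine ⟨k₀, ?_⟩
  rw [hd]
  exact_mod_cast hk₀ k₀ le_rfl

end HauserPerlega

end Literature.Barriers.ResolutionOfSingularities
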